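import Mathlib

/-!
# EriceRemainderEnclosureHistoryAutonomyComparisonAgeCompositionStaticChain — (E72a) THE STATIC CHAIN AS A RECURSION ON DATA: closed form and compounding
# identities of the carried ratios, the ABEL FORM and the product bounds of the chain load, and the MAJORANT PRINCIPLE (the static chain is monotone in its
# data — every closing majorant chain closes it)

Cell `pub-balaban`, β-function sub-cell, BINDER row D4 «RemainderConst leaves for Bałaban's split» (`HOME/BINDER-OWNERS.md`; owner lineage `b2b-balaban-beta-an4`;
this file by co-owner #2 lineage `b2b-balaban-beta-d4-p2`, generation 63), β-FLOW TEAM duty (1), FREEZE (0) honoured (def-free, Mathlib only; (E71a)–(E71d) are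
referred to BY NAME, nothing restated).

HONEST FRAMING (page 1, verbatim and binding).  *"Discharging BetaPertH makes Bałaban's UV stability UNCONDITIONAL — a real constructive-QFT result; it is
NOT the continuum limit and NOT the Clay problem."*  THIS FILE DISCHARGES NOTHING OF THE KIND.  Elementary algebra of finite sums and products of real numbers —
hypotheses of a census, not facts; the form, signs, ages and moments of Bałaban's (1.22) limit functional are NOT PRINTED ([I] p. 298; GAPS G-t4-U2-1∕-2) and
NOT asserted.  Row D4 class UNCHANGED (critical-path width 0; instance 0∕1; D4 DISCHARGE NO DATE).  HONEST DEPENDENCY: continuum YM on T⁴ ⇐ BetaPertH ∧ nine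
spine estimates (0/9 proved); BetaPertH ⇐ (D1) ∧ (D4) ∧ CAP+tail; G-an2-4 gates asym, D1 and NE2/3/4.

THE OBJECT (census sense (α); the COMPARISON column, conjecture (E58′), route (N) of `HOME/b2b-balaban-beta-d4-p2/g62/e71/README.md` §PS–PS4 and
`g63/e72/README.md`).  The static chain of (E71d) `…AgeCompositionSandwich` (`surplus_sandwich`, `drop_ratio_step`) is displayed here for the first time as a
RECURSION ON DATA (hypotheses `hρ`, `hnew`, `hold` of §3): at a pin the ages are processed OLDEST → YOUNGEST; step `m` (young age of the step; older ages =
the steps `i < m`) has the KEY ratio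
  `ρ_m = x_m·(1 + Σ_{i<m} θ_{m,i}·b_{m,i}) ∕ (1 − Ω_m)`,   then   `b_{m+1,i} = b_{m,i}∕(1−ρ_m)` (`i < m`),  `b_{m+1,m} = ρ_m∕(1−ρ_m)`
(`x_m` the young damped load, `Ω_m` the older mass inside the young window, `θ_{m,i}` the persistence defect of the older age `i` over the young window,
`b_{m,i}` the carried drop-to-surplus ratio).  Route (N) END-TO-END ((E71b) `nonneg_of_key_mono` + (E71c) `key_of_harnack_load` + (E71d)): the first-order
(E58′) for a finite profile ⟸ `ρ_m < 1` at every step of every pin ∧ MONO ∧ MONO′.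

WHAT THIS FILE ADDS (all [folklore]; 0 `def`, 0 sorry).
§1 COMPOUNDING IDENTITIES.  `beta_closed_form`: `b_{m,i} = ρ_i·Π_{i≤j<m}(1−ρ_j)⁻¹`; `rho_mul_compounding`, `sum_rho_mul_compounding`: `Σ_{i<m} b_{m,i} =
Π_{j<m}(1−ρ_j)⁻¹ − 1`; `abel_sum`, **`load_abel`**: for ANY defects `θ_i` the chain load is `Σ_{i<m} θ_i·b_{m,i} = Σ_{i<m} (θ_i − θ_{i−1})·(E_i − 1)` with
`E_i = Π_{i≤j<m}(1−ρ_j)⁻¹` the compounding of the ages NEARER than `i` (defects non-decreasing towards the young age ⟹ every increment `≥ 0`: the load is an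
average of «compounding − 1» over the scale ratios at which the defect varies); `compounding_tail_le`; `load_le_top_mul` (load ≤ top defect × (total
compounding − 1)).
§2 FIXED TARGET.  `load_eq_sum`; **`one_add_load_succ_mul`**: `(1 + V_{m+1})(1 − ρ_m) = (1 + V_m) − (1 − θ_m)ρ_m`; `load_nonneg`; `one_add_load_le_prod` and
`prod_le_one_add_load`: `Π_{j<m}(1 + θ_jρ_j∕(1−ρ_j)) ≤ 1 + V_m ≤ Π_{j<m}(1−ρ_j)⁻¹` for defects in `[0,1]`.
§3 **THE MAJORANT PRINCIPLE** (`ratio_le_of_data_le`, **`chain_le_of_data_le`**, **`ratio_le_of_majorant`**): two static chains with ordered data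
`0 ≤ x ≤ x'`, `0 ≤ θ ≤ θ'`, `Ω ≤ Ω' < 1`; if the primed chain closes (`ρ' < 1` on the first `M` steps) then `0 ≤ b ≤ b'` and `0 ≤ ρ ≤ ρ' < 1` on those steps.
This LICENSES every crude∕majorant chain of the READMEs — `x̃ ≤ x` (undamped young load), `Ω ≤ √2·W` ((E65a) at the young scale), `θ̂_k(m;y) ≤ θ̄(k∕y) =
1 − (r∕(r+1))^{3∕2}e^{−1∕(2r)}` ((E58b)∕(E63a)) `≤ 2∕(r + a)` (`a ≤ 1.375`, checked numerically on `r ∈ [1, 2000]`; `θ̄ = 2∕r − 2.75∕r² + O(r⁻³)`): the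
closure of any of them at a pin implies the closure of the static chain there, hence KEY at every age and the first-order surplus `≥ 0`.  The companion file
`…StaticChainNormalForm` (E72b) turns the step inequality into the NORMAL FORM `ρ ≤ √2∕2 + x·V` and sets up the near∕far (octave) recursion.

NUMERICS OF RECORD (`HOME/b2b-balaban-beta-d4-p2/g63/numerics/`; adversarial projected ascent over (E65a)'s budget polytope, all scales; age sets {1,2} … {1..16},
{2..7}, {4..16}, {8..24}, {8..16}∪{64}, {2..7}∪{32}, 2^{0..6}, Fibonacci ≤ 34, dense clusters (y, cy] to y = 100): crude chain `sup ρ = 0.74–0.76` (gen 62's limit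
≈ 0.78); hyperbolic majorant `θ̄ ≤ 2∕(r+1.2)`: same sups (`≤ 0.77`); pure moment majorant `θ̄ ≤ 2∕r` (scalar state `Σ_k β_k∕k`): BREAKS on dense sets
({4..12}, {8..24}, {2..7}∪{32}) — the factor `2∕θ̄(1) = 2.5` lost at scale ratio 1 is not affordable; dense near clusters themselves are harmless (`ρ ≤ 0.67`).
NOT CLAIMED: the static closure (budget form or flow form); `θ̄ ≤ 2∕(r+a)` as a theorem; MONO; (E58′); anything nonlinear; anything printed.
-/
noncomputable section
open Finset

namespace Summit.QuantumFields.BalabanUV.Beta.EriceRemainderEnclosureHistoryAutonomyComparisonAgeCompositionStaticChain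

/-! ## §1 Compounding identities of the static chain -/

/-- **CLOSED FORM OF THE CARRIED RATIOS.**  The static chain's update `b_{m+1,i} = b_{m,i}∕(1−ρ_m)` (`i < m`), `b_{m+1,m} = ρ_m∕(1−ρ_m)` gives
`b_{m,i} = ρ_i·Π_{j∈[i,m)} (1−ρ_j)⁻¹` for `i < m`: the ratio of age `i` is its own KEY ratio times the COMPOUNDING of all ages nearer than it (itself included).
[folklore] -/
theorem beta_closed_form {ρ : ℕ → ℝ} {b : ℕ → ℕ → ℝ}
    (hnew : ∀ m, b (m + 1) m = ρ m / (1 - ρ m))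
    (hold : ∀ m i, i < m → b (m + 1) i = b m i / (1 - ρ m)) :
    ∀ m i, i < m → b m i = ρ i * ∏ j ∈ Ico i m, (1 - ρ j)⁻¹ := by
  intro m
  induction m with
  | zero => intro i hi; omega
  | succ m ih =>
    intro i hi
    rcases Nat.lt_succ_iff_lt_or_eq.mp hi with h | h
    · rw [hold m i h, ih i h, prod_Ico_succ_top (by omega : i ≤ m), div_eq_mul_inv]
      ring
    · subst h
      rw [hnew, prod_Ico_succ_top le_rfl, Ico_self, prod_empty, one_mul, div_eq_mul_inv]

/-- One compounding step: with `E_i = Π_{j∈[i,m)}(1−ρ_j)⁻¹`, `ρ_i·E_i = E_i − E_{i+1}` (`i < m`, `ρ_i ≠ 1`). [folklore] -/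
theorem rho_mul_compounding {ρ : ℕ → ℝ} {i m : ℕ} (him : i < m) (hρi : ρ i ≠ 1) :
    ρ i * ∏ j ∈ Ico i m, (1 - ρ j)⁻¹ = (∏ j ∈ Ico i m, (1 - ρ j)⁻¹) - ∏ j ∈ Ico (i + 1) m, (1 - ρ j)⁻¹ := by
  rw [prod_eq_prod_Ico_succ_bot him]
  have h1 : (1 - ρ i) ≠ 0 := sub_ne_zero.mpr (Ne.symm hρi)
  field_simp
  ring

/-- **TOTAL RATIO = TOTAL COMPOUNDING − 1**: `Σ_{i<m} ρ_i·Π_{j∈[i,m)}(1−ρ_j)⁻¹ = Π_{j<m}(1−ρ_j)⁻¹ − 1` (telescoping). [folklore] -/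
theorem sum_rho_mul_compounding {ρ : ℕ → ℝ} {m : ℕ} (hρ : ∀ j, j < m → ρ j ≠ 1) :
    ∑ i ∈ range m, ρ i * ∏ j ∈ Ico i m, (1 - ρ j)⁻¹ = (∏ j ∈ range m, (1 - ρ j)⁻¹) - 1 := by
  have h := Finset.sum_range_sub' (fun i => ∏ j ∈ Ico i m, (1 - ρ j)⁻¹) m
  simp only [Ico_self, prod_empty, Nat.Ico_zero_eq_range] at h
  rw [← h]
  exact sum_congr rfl fun i hi => rho_mul_compounding (mem_range.mp hi) (hρ i (mem_range.mp hi))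

/-- ABEL SUMMATION with an explicit predecessor sequence `θp` (`θp 0 = 0`, `θp (i+1) = θ i`):
`Σ_{i<m} θ_i·(a_i − a_{i+1}) = Σ_{i<m} (θ_i − θ_{i−1})·(a_i − a_m)`. [folklore] -/
theorem abel_sum (θ θp a : ℕ → ℝ) (h0 : θp 0 = 0) (hp : ∀ i, θp (i + 1) = θ i) (m : ℕ) :
    ∑ i ∈ range m, θ i * (a i - a (i + 1)) = ∑ i ∈ range m, (θ i - θp i) * (a i - a m) := by
  have htel : ∀ n, ∑ i ∈ range n, (θ i - θp i) = θp n := by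
    intro n
    induction n with
    | zero => simp [h0]
    | succ n ih => rw [sum_range_succ, ih, hp]; ring
  induction m with
  | zero => simp
  | succ m ih =>
    rw [sum_range_succ, ih, sum_range_succ]
    have hsplit : ∑ i ∈ range m, (θ i - θp i) * (a i - a (m + 1)) =
        ∑ i ∈ range m, (θ i - θp i) * (a i - a m) + (a m - a (m + 1)) * θp m := by
      rw [← htel m, mul_sum, ← sum_add_distrib]
      exact sum_congr rfl fun i _ => by ring
    rw [hsplit, ← hp m]
    ring

/-- **ABEL FORM OF THE CHAIN LOAD.**  For ANY defect sequence `θ` (predecessor sequence `θp`), the load the young age sees is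
`Σ_{i<m} θ_i·b_{m,i} = Σ_{i<m} θ_i·ρ_i·E_i = Σ_{i<m} (θ_i − θ_{i−1})·(E_i − 1)` with `E_i = Π_{j∈[i,m)}(1−ρ_j)⁻¹` the compounding of the ages nearer than `i`
(and `θ_{−1} = 0`).  When the defects are non-decreasing towards the young age (persistence defects `θ̄(k∕y)` are: `θ̄` is decreasing in the scale ratio) every
increment is `≥ 0` and the load is an AVERAGE OF «COMPOUNDING − 1» over the scale ratios at which the defect varies — far ages enter with their own small
increments but with the full compounding of everything nearer. [folklore] -/
theorem load_abel {ρ : ℕ → ℝ} {m : ℕ} (hρ : ∀ j, j < m → ρ j ≠ 1) (θ θp : ℕ → ℝ) (h0 : θp 0 = 0) (hp : ∀ i, θp (i + 1) = θ i) :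
    ∑ i ∈ range m, θ i * (ρ i * ∏ j ∈ Ico i m, (1 - ρ j)⁻¹) =
      ∑ i ∈ range m, (θ i - θp i) * ((∏ j ∈ Ico i m, (1 - ρ j)⁻¹) - 1) := by
  have h := abel_sum θ θp (fun i => ∏ j ∈ Ico i m, (1 - ρ j)⁻¹) h0 hp m
  simp only [Ico_self, prod_empty] at h
  rw [← h]
  exact sum_congr rfl fun i hi => by rw [rho_mul_compounding (mem_range.mp hi) (hρ i (mem_range.mp hi))]

/-- Products of real factors `≥ 1` are `≥ 1`. [folklore] -/
theorem one_le_prod_of_one_le {s : Finset ℕ} {f : ℕ → ℝ} (hf : ∀ i ∈ s, 1 ≤ f i) : 1 ≤ ∏ i ∈ s, f i := by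
  calc (1 : ℝ) = ∏ i ∈ s, (1 : ℝ) := by simp
    _ ≤ ∏ i ∈ s, f i := prod_le_prod (fun i _ => zero_le_one) hf

/-- Tail compoundings are dominated by the total compounding: `Π_{j∈[i,m)}(1−ρ_j)⁻¹ ≤ Π_{j<m}(1−ρ_j)⁻¹` for ratios in `[0,1)`. [folklore] -/
theorem compounding_tail_le {ρ : ℕ → ℝ} {i m : ℕ} (him : i ≤ m) (hρ0 : ∀ j, j < m → 0 ≤ ρ j) (hρ1 : ∀ j, j < m → ρ j < 1) :
    ∏ j ∈ Ico i m, (1 - ρ j)⁻¹ ≤ ∏ j ∈ range m, (1 - ρ j)⁻¹ := by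
  -- the compounding factor `(1 − ρ_j)⁻¹` of a ratio in `[0,1)` is `≥ 1`
  have hinv : ∀ j, j < m → 1 ≤ (1 - ρ j)⁻¹ := fun j hj => by
    rw [le_inv_comm₀ one_pos (by linarith [hρ1 j hj]), inv_one]; linarith [hρ0 j hj]
  rw [← Nat.Ico_zero_eq_range, ← prod_Ico_consecutive _ (Nat.zero_le i) him]
  have h1 : 1 ≤ ∏ j ∈ Ico 0 i, (1 - ρ j)⁻¹ :=
    one_le_prod_of_one_le fun j hj => hinv j (lt_of_lt_of_le (mem_Ico.mp hj).2 him)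
  have h2 : 0 ≤ ∏ j ∈ Ico i m, (1 - ρ j)⁻¹ :=
    prod_nonneg fun j hj => le_trans zero_le_one (hinv j (mem_Ico.mp hj).2)
  nlinarith

/-- **CRUDE BOUND.**  For defects non-decreasing towards the young age (`θ_{i−1} ≤ θ_i`, `θ_{−1} = 0`) and ratios in `[0,1)`:
`Σ_{i<m} θ_i·b_{m,i} ≤ θ_{m−1}·(Π_{j<m}(1−ρ_j)⁻¹ − 1)` — load ≤ top defect × (total compounding − 1).  (Sharp only when all the load sits at the nearest age;
the octave recursion of §5 is the usable refinement.) [folklore] -/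
theorem load_le_top_mul {ρ : ℕ → ℝ} {m : ℕ} (hρ0 : ∀ j, j < m → 0 ≤ ρ j) (hρ1 : ∀ j, j < m → ρ j < 1)
    (θ θp : ℕ → ℝ) (h0 : θp 0 = 0) (hp : ∀ i, θp (i + 1) = θ i) (hmono : ∀ i, i < m → θp i ≤ θ i) :
    ∑ i ∈ range m, θ i * (ρ i * ∏ j ∈ Ico i m, (1 - ρ j)⁻¹) ≤ θp m * ((∏ j ∈ range m, (1 - ρ j)⁻¹) - 1) := by
  rw [load_abel (fun j hj => (hρ1 j hj).ne) θ θp h0 hp]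
  have htel : ∀ n, ∑ i ∈ range n, (θ i - θp i) = θp n := by
    intro n
    induction n with
    | zero => simp [h0]
    | succ n ih => rw [sum_range_succ, ih, hp]; ring
  calc ∑ i ∈ range m, (θ i - θp i) * ((∏ j ∈ Ico i m, (1 - ρ j)⁻¹) - 1)
      ≤ ∑ i ∈ range m, (θ i - θp i) * ((∏ j ∈ range m, (1 - ρ j)⁻¹) - 1) :=
        sum_le_sum fun i hi => mul_le_mul_of_nonneg_left
          (sub_le_sub_right (compounding_tail_le (mem_range.mp hi).le hρ0 hρ1) 1)
          (sub_nonneg.mpr (hmono i (mem_range.mp hi)))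
    _ = θp m * ((∏ j ∈ range m, (1 - ρ j)⁻¹) - 1) := by rw [← sum_mul, htel]


/-! ## §2 The load seen from a fixed target: transport identity and product bounds -/

/-- FIXED TARGET.  The load seen from a fixed young scale with fixed defects `θ_i`, transported step by step as `V_{m+1} = (V_m + θ_mρ_m)∕(1−ρ_m)`
(`V_0 = 0`: each new age compounds the load already present and adds its own), equals the closed form `Σ_{i<m} θ_i·ρ_i·Π_{j∈[i,m)}(1−ρ_j)⁻¹`. [folklore] -/
theorem load_eq_sum {ρ θ V : ℕ → ℝ} (hV0 : V 0 = 0)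
    (hV : ∀ m, V (m + 1) = (V m + θ m * ρ m) / (1 - ρ m)) :
    ∀ m, V m = ∑ i ∈ range m, θ i * (ρ i * ∏ j ∈ Ico i m, (1 - ρ j)⁻¹) := by
  intro m
  induction m with
  | zero => simp [hV0]
  | succ m ih =>
    rw [hV m, ih, sum_range_succ, prod_Ico_succ_top le_rfl, Ico_self, prod_empty, one_mul, div_eq_mul_inv, add_mul,
      sum_mul]
    congr 1
    · exact sum_congr rfl fun i hi => by rw [prod_Ico_succ_top (mem_range.mp hi).le]; ring
    · ring

/-- **TRANSPORT IDENTITY.**  `(1 + V_{m+1})·(1 − ρ_m) = (1 + V_m) − (1 − θ_m)·ρ_m`: a defect-one age multiplies `1 + V` by its full compounding factor,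
a defect-zero age compounds only the load already present. [folklore] -/
theorem one_add_load_succ_mul {ρ θ V : ℕ → ℝ} (hρ1 : ∀ m, ρ m < 1)
    (hV : ∀ m, V (m + 1) = (V m + θ m * ρ m) / (1 - ρ m)) (m : ℕ) :
    (1 + V (m + 1)) * (1 - ρ m) = (1 + V m) - (1 - θ m) * ρ m := by
  have h1 : (1 - ρ m) ≠ 0 := (sub_pos.mpr (hρ1 m)).ne'
  rw [hV m]
  field_simp
  ring

/-- The transported load is non-negative (defects and ratios `≥ 0`, ratios `< 1`). [folklore] -/
theorem load_nonneg {ρ θ V : ℕ → ℝ} (hρ0 : ∀ m, 0 ≤ ρ m) (hρ1 : ∀ m, ρ m < 1) (hθ0 : ∀ m, 0 ≤ θ m) (hV0 : V 0 = 0)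
    (hV : ∀ m, V (m + 1) = (V m + θ m * ρ m) / (1 - ρ m)) : ∀ m, 0 ≤ V m := by
  intro m
  induction m with
  | zero => rw [hV0]
  | succ m ih => rw [hV m]; exact div_nonneg (add_nonneg ih (mul_nonneg (hθ0 m) (hρ0 m))) (sub_pos.mpr (hρ1 m)).le

/-- **UPPER PRODUCT BOUND.**  With defects `≤ 1` and ratios in `[0,1)`: `1 + V_m ≤ Π_{j<m}(1−ρ_j)⁻¹` — the load plus one never exceeds the total
compounding. [folklore] -/
theorem one_add_load_le_prod {ρ θ V : ℕ → ℝ} (hρ0 : ∀ m, 0 ≤ ρ m) (hρ1 : ∀ m, ρ m < 1)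
    (hθ1 : ∀ m, θ m ≤ 1) (hV0 : V 0 = 0) (hV : ∀ m, V (m + 1) = (V m + θ m * ρ m) / (1 - ρ m)) :
    ∀ m, 1 + V m ≤ ∏ j ∈ range m, (1 - ρ j)⁻¹ := by
  intro m
  induction m with
  | zero => simp [hV0]
  | succ m ih =>
    have hpos : 0 < 1 - ρ m := sub_pos.mpr (hρ1 m)
    have hstep : 1 + V (m + 1) ≤ (1 + V m) * (1 - ρ m)⁻¹ := by
      rw [← div_eq_mul_inv, le_div_iff₀ hpos, one_add_load_succ_mul hρ1 hV m]
      nlinarith [hθ1 m, hρ0 m]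
    have hP : 0 ≤ ∏ j ∈ range m, (1 - ρ j)⁻¹ := prod_nonneg fun j _ => (inv_pos.mpr (sub_pos.mpr (hρ1 j))).le
    calc 1 + V (m + 1) ≤ (1 + V m) * (1 - ρ m)⁻¹ := hstep
      _ ≤ (∏ j ∈ range m, (1 - ρ j)⁻¹) * (1 - ρ m)⁻¹ := mul_le_mul_of_nonneg_right ih (inv_pos.mpr hpos).le
      _ = ∏ j ∈ range (m + 1), (1 - ρ j)⁻¹ := (prod_range_succ _ m).symm

/-- **LOWER PRODUCT BOUND.**  With defects in `[0,1]` and ratios in `[0,1)`: `Π_{j<m}(1 + θ_jρ_j∕(1−ρ_j)) ≤ 1 + V_m` (each age contributes at least what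
it would contribute to an empty load). [folklore] -/
theorem prod_le_one_add_load {ρ θ V : ℕ → ℝ} (hρ0 : ∀ m, 0 ≤ ρ m) (hρ1 : ∀ m, ρ m < 1) (hθ0 : ∀ m, 0 ≤ θ m)
    (hθ1 : ∀ m, θ m ≤ 1) (hV0 : V 0 = 0) (hV : ∀ m, V (m + 1) = (V m + θ m * ρ m) / (1 - ρ m)) :
    ∀ m, ∏ j ∈ range m, (1 + θ j * ρ j / (1 - ρ j)) ≤ 1 + V m := by
  have hVnn := load_nonneg hρ0 hρ1 hθ0 hV0 hV
  intro m
  induction m with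
  | zero => simp [hV0]
  | succ m ih =>
    have hpos : 0 < 1 - ρ m := sub_pos.mpr (hρ1 m)
    have hfac : 0 ≤ 1 + θ m * ρ m / (1 - ρ m) := add_nonneg zero_le_one (div_nonneg (mul_nonneg (hθ0 m) (hρ0 m)) hpos.le)
    have hstep : (1 + V m) * (1 + θ m * ρ m / (1 - ρ m)) ≤ 1 + V (m + 1) := by
      have h2 : (1 + V m) * (1 + θ m * ρ m / (1 - ρ m)) = ((1 + V m) * (1 - (1 - θ m) * ρ m)) / (1 - ρ m) := by
        field_simp
        ring
      rw [h2, div_le_iff₀ hpos, one_add_load_succ_mul hρ1 hV m]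
      nlinarith [hVnn m, hθ1 m, hρ0 m, mul_nonneg (hVnn m) (mul_nonneg (sub_nonneg.mpr (hθ1 m)) (hρ0 m))]
    have hP : 0 ≤ ∏ j ∈ range m, (1 + θ j * ρ j / (1 - ρ j)) :=
      prod_nonneg fun j _ => add_nonneg zero_le_one (div_nonneg (mul_nonneg (hθ0 j) (hρ0 j)) (sub_pos.mpr (hρ1 j)).le)
    calc ∏ j ∈ range (m + 1), (1 + θ j * ρ j / (1 - ρ j))
        = (∏ j ∈ range m, (1 + θ j * ρ j / (1 - ρ j))) * (1 + θ m * ρ m / (1 - ρ m)) := prod_range_succ _ m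
      _ ≤ (1 + V m) * (1 + θ m * ρ m / (1 - ρ m)) := mul_le_mul_of_nonneg_right ih hfac
      _ ≤ 1 + V (m + 1) := hstep

/-! ## §3 The majorant principle: the static chain is monotone in its data -/

section Majorant

variable {x x' Ω Ω' ρ ρ' : ℕ → ℝ} {θ θ' b b' : ℕ → ℕ → ℝ}

/-- ONE STEP OF THE COMPARISON.  Two static chains `ρ_m = x_m(1 + Σ_{i<m}θ_{m,i}b_{m,i})∕(1−Ω_m)` and its primed version with ORDERED DATA
(`0 ≤ x ≤ x'`, `0 ≤ θ ≤ θ'`, `Ω ≤ Ω' < 1`): if the carried ratios are ordered at step `m` (`0 ≤ b_{m,i} ≤ b'_{m,i}`, `i < m`) then so are the KEY ratios,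
`0 ≤ ρ_m ≤ ρ'_m`. [folklore] -/
theorem ratio_le_of_data_le
    (hρ : ∀ m, ρ m = x m * (1 + ∑ i ∈ range m, θ m i * b m i) / (1 - Ω m))
    (hρ' : ∀ m, ρ' m = x' m * (1 + ∑ i ∈ range m, θ' m i * b' m i) / (1 - Ω' m))
    (hx : ∀ m, 0 ≤ x m ∧ x m ≤ x' m) (hθ : ∀ m i, 0 ≤ θ m i ∧ θ m i ≤ θ' m i) (hΩ : ∀ m, Ω m ≤ Ω' m ∧ Ω' m < 1)
    {m : ℕ} (hb : ∀ i, i < m → 0 ≤ b m i ∧ b m i ≤ b' m i) : 0 ≤ ρ m ∧ ρ m ≤ ρ' m := by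
  have hS : ∑ i ∈ range m, θ m i * b m i ≤ ∑ i ∈ range m, θ' m i * b' m i :=
    sum_le_sum fun i hi => by
      have h := hb i (mem_range.mp hi)
      exact mul_le_mul (hθ m i).2 h.2 h.1 ((hθ m i).1.trans (hθ m i).2)
  have hS0 : 0 ≤ ∑ i ∈ range m, θ m i * b m i := sum_nonneg fun i hi => mul_nonneg (hθ m i).1 (hb i (mem_range.mp hi)).1
  have hnum : x m * (1 + ∑ i ∈ range m, θ m i * b m i) ≤ x' m * (1 + ∑ i ∈ range m, θ' m i * b' m i) :=
    mul_le_mul (hx m).2 (by linarith) (by linarith) ((hx m).1.trans (hx m).2)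
  have hnum0 : 0 ≤ x m * (1 + ∑ i ∈ range m, θ m i * b m i) := mul_nonneg (hx m).1 (by linarith)
  have hd' : 0 < 1 - Ω' m := sub_pos.mpr (hΩ m).2
  have hd : 1 - Ω' m ≤ 1 - Ω m := by linarith [(hΩ m).1]
  rw [hρ m, hρ' m]
  exact ⟨div_nonneg hnum0 (hd'.le.trans hd), div_le_div₀ (hnum0.trans hnum) hnum hd' hd⟩

/-- **THE MAJORANT PRINCIPLE FOR THE STATIC CHAIN.**  Two static chains (KEY ratio `ρ_m = x_m(1 + Σ_{i<m}θ_{m,i}b_{m,i})∕(1−Ω_m)`, update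
`b_{m+1,i} = b_{m,i}∕(1−ρ_m)`, `b_{m+1,m} = ρ_m∕(1−ρ_m)`) with ordered data `0 ≤ x ≤ x'`, `0 ≤ θ ≤ θ'`, `Ω ≤ Ω' < 1`.  If the PRIMED (majorant) chain closes on
the first `M` steps (`ρ'_m < 1`, `m < M`) then the carried ratios are ordered on those steps: `0 ≤ b_{m,i} ≤ b'_{m,i}` (`i < m ≤ M`).  Use (route (N)): the
static chain of (E71d) has data `(x̃, θ̂, Ω)`; ANY chain with larger data — the crude chain `(x, θ̄(k∕y), √2W)` of README §PS3, the hyperbolic chain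
`(x, 2∕(k∕y + a), √2W)` — that closes at a pin forces the static chain to close there, with smaller ratios. [folklore] -/
theorem chain_le_of_data_le
    (hρ : ∀ m, ρ m = x m * (1 + ∑ i ∈ range m, θ m i * b m i) / (1 - Ω m))
    (hρ' : ∀ m, ρ' m = x' m * (1 + ∑ i ∈ range m, θ' m i * b' m i) / (1 - Ω' m))
    (hnew : ∀ m, b (m + 1) m = ρ m / (1 - ρ m)) (hold : ∀ m i, i < m → b (m + 1) i = b m i / (1 - ρ m))
    (hnew' : ∀ m, b' (m + 1) m = ρ' m / (1 - ρ' m)) (hold' : ∀ m i, i < m → b' (m + 1) i = b' m i / (1 - ρ' m))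
    (hx : ∀ m, 0 ≤ x m ∧ x m ≤ x' m) (hθ : ∀ m i, 0 ≤ θ m i ∧ θ m i ≤ θ' m i) (hΩ : ∀ m, Ω m ≤ Ω' m ∧ Ω' m < 1)
    {M : ℕ} (hclose : ∀ m, m < M → ρ' m < 1) :
    ∀ m, m ≤ M → ∀ i, i < m → 0 ≤ b m i ∧ b m i ≤ b' m i := by
  intro m
  induction m with
  | zero => intro _ i hi; omega
  | succ m ih =>
    intro hm i hi
    have hbm := ih (by omega)
    have hr := ratio_le_of_data_le hρ hρ' hx hθ hΩ hbm
    have hr'1 : ρ' m < 1 := hclose m (by omega)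
    have hd' : 0 < 1 - ρ' m := sub_pos.mpr hr'1
    have hd : 1 - ρ' m ≤ 1 - ρ m := by linarith [hr.2]
    rcases Nat.lt_succ_iff_lt_or_eq.mp hi with h | h
    · rw [hold m i h, hold' m i h]
      have hbi := hbm i h
      exact ⟨div_nonneg hbi.1 (hd'.le.trans hd), div_le_div₀ (hbi.1.trans hbi.2) hbi.2 hd' hd⟩
    · subst h
      rw [hnew, hnew']
      exact ⟨div_nonneg hr.1 (hd'.le.trans hd), div_le_div₀ (hr.1.trans hr.2) hr.2 hd' hd⟩

/-- **A CLOSING MAJORANT CHAIN CLOSES THE CHAIN**: in the setting of `chain_le_of_data_le`, `0 ≤ ρ_m ≤ ρ'_m < 1` for every `m < M`. [folklore] -/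
theorem ratio_le_of_majorant
    (hρ : ∀ m, ρ m = x m * (1 + ∑ i ∈ range m, θ m i * b m i) / (1 - Ω m))
    (hρ' : ∀ m, ρ' m = x' m * (1 + ∑ i ∈ range m, θ' m i * b' m i) / (1 - Ω' m))
    (hnew : ∀ m, b (m + 1) m = ρ m / (1 - ρ m)) (hold : ∀ m i, i < m → b (m + 1) i = b m i / (1 - ρ m))
    (hnew' : ∀ m, b' (m + 1) m = ρ' m / (1 - ρ' m)) (hold' : ∀ m i, i < m → b' (m + 1) i = b' m i / (1 - ρ' m))
    (hx : ∀ m, 0 ≤ x m ∧ x m ≤ x' m) (hθ : ∀ m i, 0 ≤ θ m i ∧ θ m i ≤ θ' m i) (hΩ : ∀ m, Ω m ≤ Ω' m ∧ Ω' m < 1)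
    {M : ℕ} (hclose : ∀ m, m < M → ρ' m < 1) :
    ∀ m, m < M → 0 ≤ ρ m ∧ ρ m ≤ ρ' m ∧ ρ m < 1 := fun m hm => by
  have h := ratio_le_of_data_le hρ hρ' hx hθ hΩ (chain_le_of_data_le hρ hρ' hnew hold hnew' hold' hx hθ hΩ hclose m hm.le)
  exact ⟨h.1, h.2, lt_of_le_of_lt h.2 (hclose m hm)⟩

end Majorant

end Summit.QuantumFields.BalabanUV.Beta.EriceRemainderEnclosureHistoryAutonomyComparisonAgeCompositionStaticChain

end
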